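import Summits.QuantumFields.YangMills.Theorems.TwistExponentGapGaugeOrbitTubeVolume
import Summits.QuantumFields.YangMills.Theorems.TwistExponentGapLaplaceOfSublevel
import Summits.QuantumFields.YangMills.Theorems.EquipartitionCriticalityEquipartitionPinsProbeLiePos
import Summits.QuantumFields.YangMills.Theorems.EquipartitionCriticalityEquipartitionPinsProbeTangentDefs
import Summits.QuantumFields.YangMills.Theses.TwistExponentGap
import HarnessLib

/-!
# `RigidTwistCeiling` ⟨stmt-QuantumFields-24054⟩ reduced to ONE gauge-invariant Morse–Bott inequality
# (helper, route `TwistExponentGap`, planner ym-idea-4 g13; free hands of width seat ym-line-sfw-p2-w3)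

The crux asks, for every compact simple `G`, faithful lattice representation `r` (`D = dimE r.ρ`), side `S ≥ 2`,
central `z ≠ 1` all of whose commutator pairs have finite centraliser, and plane `q`, for the ceiling
`Z_{β,S}(z;q) ≤ C·β^{−((3S⁴−1)D/2 + δ)}` (`β ≥ β₀`, some `δ > 0`).  Its BC3 birth skeleton (HOME
`pub/ideators/ym-idea-4/bc/g13-A/RigidTwistCeiling_birth.lean`) splits it into an analytic stub — PROVED in the tree as
`TwistExponentGap.laplace_of_sublevel` (✓p755406) — and a geometric stub (Morse–Bott sublevel volume bound).  This file
splits the geometric stub once more and kernel-checks the whole chain, so that the ONE remaining content is a single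
displayed inequality with NO gauge fixing:

**(MB) Morse–Bott inequality for the `z`-twisted Wilson action** `S_z(U) = Σ_p (N − Re tr r.ρ(z_p U_p))` on the side-`S`
four-torus: there are finitely many configurations `W₁,…,W_m`, `c > 0` and `t₀ > 0` such that every `U` with `S_z(U) ≤ t₀`
is, up to a lattice gauge transformation of some `W_i` (tree `gaugeTransform`), quadratically close in the Hilbert–Schmidt
chart: `c·‖r.ρ(U_e) − r.ρ((g·W_i)_e)‖² ≤ S_z(U)` for every link `e`.  (Expected from pair-rigidity: the `z`-twisted flat
lattice connections are finitely many gauge orbits, each infinitesimally rigid — `h¹ = 4h⁰ = 0` for commuting unitary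
holonomies with no joint fixed vector — so the action grows quadratically off them; NOT proved here.)

What IS proved here (no `sorry`, standard axioms):
* `sublevel_measureReal_le_of_quadraticGrowth` — ABSTRACT: for any function `A` on `G^ι`, finitely many centres and a
  quadratic-growth hypothesis of the shape (MB) w.r.t. the action `V_e ↦ g(s e) V_e g(t e)⁻¹` of `G^κ`, the sublevel sets
  satisfy `Haar^ι{A ≤ u} ≤ C·u^{D(|ι|−|κ|)/2}` for `0 < u ≤ t₁` (the gauge-orbit tube volume
  `gaugeOrbitTube_measureReal_le` at radius `√(u/c)`).
* `rigidTwistCeiling_of_morseBott` — (MB), stated under exactly the crux's hypotheses, implies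
  `TwistExponentGap.RigidTwistCeiling` BY NAME with `δ = D/2`: `|links| − |sites| = 4S⁴ − S⁴ = 3S⁴`, so the sublevel
  exponent is `3S⁴D/2 = (3S⁴−1)D/2 + D/2`, and `laplace_of_sublevel` turns it into the ceiling (`D > 0` for a compact
  simple `G`: tree `EquipartitionPinsProbe.stub_liePos` + `dimE_eq_lieDim`).
HONEST FRAMING: bookkeeping around an unproved inequality; the Morse–Bott content of ⟨24054⟩ is exactly (MB) and remains
OPEN; nothing here bears on a summit statement or on the Yang–Mills mass gap.  No definitions, no named facts.
-/

set_option autoImplicit false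

noncomputable section

open scoped Matrix.Norms.Frobenius ENNReal BigOperators
open MeasureTheory
open Literature.MathematicalPhysics.QuantumFieldTheory
open Summit.QuantumFields.YangMills.Theorems.FreeEnergyLogCoefficient (dimE)

namespace Summit.QuantumFields.YangMills.Theorems.TwistExponentGap

/-! ## §1 Sublevel volumes from quadratic growth off finitely many gauge orbits (abstract) -/

section Abstract

variable {G : Type*} [Group G] [TopologicalSpace G] [IsTopologicalGroup G] [CompactSpace G]
  [MeasurableSpace G] [BorelSpace G] {N : ℕ} (ρ : G →* Matrix (Fin N) (Fin N) ℂ)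

/-- **Sublevel volume from quadratic growth.** If every `V` with `A V ≤ t₀` is within `√(A V / c)` (link by link, in the
Hilbert–Schmidt chart of `ρ`) of the `G^κ`-gauge orbit of one of finitely many centres `W_i`, then
`Haar^ι{A ≤ u} ≤ C·u^{D(|ι|−|κ|)/2}` for all `0 < u ≤ t₁` (`t₁ = min t₀ c`, natural exponent `D(|ι|−|κ|)` halved as a real). -/
theorem sublevel_measureReal_le_of_quadraticGrowth {ι κ : Type*} [Fintype ι] [Fintype κ] (s t : ι → κ)
    (hρ : Continuous ρ) (hinj : Function.Injective ρ) (hU : ∀ g, ρ g ∈ Matrix.unitaryGroup (Fin N) ℂ)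
    (A : (ι → G) → ℝ) {m : ℕ} (W : Fin m → ι → G) {c t₀ : ℝ} (hc : 0 < c) (ht₀ : 0 < t₀)
    (hMB : ∀ V : ι → G, A V ≤ t₀ → ∃ i : Fin m, ∃ g : κ → G, ∀ e,
      c * ‖ρ (V e) - ρ (g (s e) * W i e * (g (t e))⁻¹)‖ ^ 2 ≤ A V) :
    ∃ C t₁ : ℝ, 0 < C ∧ 0 < t₁ ∧ ∀ u : ℝ, 0 < u → u ≤ t₁ →
      ((Measure.pi fun _ : ι => haarProbability G) {V | A V ≤ u}).toReal ≤
        C * u ^ (((dimE ρ * (Fintype.card ι - Fintype.card κ) : ℕ) : ℝ) / 2) := by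
  classical
  obtain ⟨C₀, hC₀, htube⟩ := gaugeOrbitTube_measureReal_le ρ s t hρ hinj hU
  set n : ℕ := dimE ρ * (Fintype.card ι - Fintype.card κ) with hn
  refine ⟨(m : ℝ) * C₀ * (c ^ ((n : ℝ) / 2))⁻¹ + 1, min t₀ c, by positivity, lt_min ht₀ hc,
    fun u hu hut₁ => ?_⟩
  have hut₀ : u ≤ t₀ := hut₁.trans (min_le_left _ _)
  have huc : u ≤ c := hut₁.trans (min_le_right _ _)
  set μ := (Measure.pi fun _ : ι => haarProbability G) with hμ
  haveI : IsProbabilityMeasure μ := by rw [hμ]; infer_instance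
  set rad : ℝ := Real.sqrt (u / c) with hrad
  have huc' : 0 < u / c := div_pos hu hc
  have hrad_pos : 0 < rad := Real.sqrt_pos.2 huc'
  have hrad_le : rad ≤ 1 := by
    rw [hrad, Real.sqrt_le_one]
    exact (div_le_one hc).2 huc
  -- the tubes
  set tube : Fin m → Set (ι → G) := fun i =>
    {V : ι → G | ∃ g : κ → G, ∀ e, ‖ρ (V e) - ρ (g (s e) * W i e * (g (t e))⁻¹)‖ ≤ rad} with htube_def
  have hcover : {V : ι → G | A V ≤ u} ⊆ ⋃ i ∈ (Finset.univ : Finset (Fin m)), tube i := by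
    intro V hV
    have hV' : A V ≤ u := hV
    obtain ⟨i, g, hg⟩ := hMB V (hV'.trans hut₀)
    refine Set.mem_biUnion (Finset.mem_coe.2 (Finset.mem_univ i)) ?_
    rw [htube_def]
    refine ⟨g, fun e => ?_⟩
    have h1 : c * ‖ρ (V e) - ρ (g (s e) * W i e * (g (t e))⁻¹)‖ ^ 2 ≤ u := (hg e).trans hV'
    have h2 : ‖ρ (V e) - ρ (g (s e) * W i e * (g (t e))⁻¹)‖ ^ 2 ≤ u / c := by
      rw [le_div_iff₀ hc, mul_comm]; exact h1
    calc ‖ρ (V e) - ρ (g (s e) * W i e * (g (t e))⁻¹)‖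
        = Real.sqrt (‖ρ (V e) - ρ (g (s e) * W i e * (g (t e))⁻¹)‖ ^ 2) :=
          (Real.sqrt_sq (norm_nonneg _)).symm
      _ ≤ rad := Real.sqrt_le_sqrt h2
  have hμi : ∀ i : Fin m, μ.real (tube i) ≤ C₀ * rad ^ n := fun i => htube (W i) rad hrad_pos hrad_le
  -- `rad ^ n = u^{n/2} / c^{n/2}`
  have hradn : rad ^ n = u ^ ((n : ℝ) / 2) * (c ^ ((n : ℝ) / 2))⁻¹ := by
    rw [hrad, Real.sqrt_eq_rpow, ← Real.rpow_natCast, ← Real.rpow_mul huc'.le,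
      show (1 / 2 : ℝ) * (n : ℝ) = (n : ℝ) / 2 by ring, Real.div_rpow hu.le hc.le, div_eq_mul_inv]
  have hupow : 0 ≤ u ^ ((n : ℝ) / 2) := Real.rpow_nonneg hu.le _
  calc (μ {V : ι → G | A V ≤ u}).toReal = μ.real {V : ι → G | A V ≤ u} := rfl
    _ ≤ μ.real (⋃ i ∈ (Finset.univ : Finset (Fin m)), tube i) := measureReal_mono hcover (measure_ne_top _ _)
    _ ≤ ∑ i ∈ (Finset.univ : Finset (Fin m)), μ.real (tube i) := measureReal_biUnion_finset_le _ _
    _ ≤ ∑ _i ∈ (Finset.univ : Finset (Fin m)), C₀ * rad ^ n := Finset.sum_le_sum fun i _ => hμi i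
    _ = (m : ℝ) * (C₀ * rad ^ n) := by rw [Finset.sum_const, Finset.card_univ, Fintype.card_fin, nsmul_eq_mul]
    _ = (m : ℝ) * C₀ * (c ^ ((n : ℝ) / 2))⁻¹ * u ^ ((n : ℝ) / 2) := by rw [hradn]; ring
    _ ≤ ((m : ℝ) * C₀ * (c ^ ((n : ℝ) / 2))⁻¹ + 1) * u ^ ((n : ℝ) / 2) := by
        have : (m : ℝ) * C₀ * (c ^ ((n : ℝ) / 2))⁻¹ ≤ (m : ℝ) * C₀ * (c ^ ((n : ℝ) / 2))⁻¹ + 1 := by linarith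
        exact mul_le_mul_of_nonneg_right this hupow

end Abstract

/-! ## §2 The crux BY NAME modulo the Morse–Bott inequality (MB) -/

/-- Link and site counts of the side-`S` four-torus: `|Edge 4 S| − |Site 4 S| = 3 S⁴`. -/
theorem card_edge_sub_card_site (S : ℕ) [NeZero S] :
    Fintype.card (Edge 4 S) - Fintype.card (Site 4 S) = 3 * S ^ 4 := by
  have hS : Fintype.card (Site 4 S) = S ^ 4 := by
    rw [Fintype.card_fun, ZMod.card, Fintype.card_fin]
  rw [Fintype.card_prod, hS, Fintype.card_fin]
  have : S ^ 4 * 4 - S ^ 4 = 3 * S ^ 4 := by omega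
  exact this

/-- **`RigidTwistCeiling` from the Morse–Bott inequality (MB).**  If, under exactly the hypotheses of the crux, the
`z`-twisted Wilson action grows quadratically (in the Hilbert–Schmidt chart of `r.ρ`, link by link) off the gauge
orbits of finitely many configurations on its small sublevel set, then `TwistExponentGap.RigidTwistCeiling` holds, with
`δ = dimE r.ρ / 2`.  The hypothesis is the one open content of ⟨stmt-QuantumFields-24054⟩. -/
theorem rigidTwistCeiling_of_morseBott
    (hMB : ∀ (G : Type) [Group G] [TopologicalSpace G] [IsTopologicalGroup G] [CompactSpace G],
      IsCompactSimpleLieGroup G → ∀ (r : LatticeRep G) (L : ℕ), 2 ≤ L + 1 →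
      ∀ z ∈ Subgroup.center G, z ≠ 1 →
      (∀ x y : G, x * y * x⁻¹ * y⁻¹ = z → Set.Finite {k : G | k * x = x * k ∧ k * y = y * k}) →
      ∀ q : {p : Fin 4 × Fin 4 // p.1 < p.2},
      ∃ (m : ℕ) (W : Fin m → GaugeConfig 4 (L + 1) G) (c t₀ : ℝ), 0 < c ∧ 0 < t₀ ∧
        ∀ U : GaugeConfig 4 (L + 1) G,
          (∑ p : Plaquette 4 (L + 1), ((r.N : ℝ) - (r.ρ ((if p.2 = q ∧ p.1 q.1.1 = 0 ∧ p.1 q.1.2 = 0 then z else 1) *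
              plaquetteHolonomy U p.1 p.2.1.1 p.2.1.2)).trace.re)) ≤ t₀ →
          ∃ i : Fin m, ∃ g : Site 4 (L + 1) → G, ∀ e : Edge 4 (L + 1),
            c * ‖r.ρ (U e) - r.ρ (gaugeTransform g (W i) e)‖ ^ 2 ≤
              ∑ p : Plaquette 4 (L + 1), ((r.N : ℝ) - (r.ρ ((if p.2 = q ∧ p.1 q.1.1 = 0 ∧ p.1 q.1.2 = 0 then z else 1) *
                plaquetteHolonomy U p.1 p.2.1.1 p.2.1.2)).trace.re)) :
    Summit.QuantumFields.YangMills.Theses.TwistExponentGap.RigidTwistCeiling := by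
  intro G _ _ _ _ hG r Z hZ S hS z hz hz1 hrig q
  obtain ⟨L, rfl⟩ : ∃ L, S = L + 1 := ⟨S - 1, by omega⟩
  letI : MeasurableSpace G := borel G
  haveI : BorelSpace G := ⟨rfl⟩
  -- the twisted action
  set A : GaugeConfig 4 (L + 1) G → ℝ := fun U =>
    ∑ p : Plaquette 4 (L + 1), ((r.N : ℝ) - (r.ρ ((if p.2 = q ∧ p.1 q.1.1 = 0 ∧ p.1 q.1.2 = 0 then z else 1) *
      plaquetteHolonomy U p.1 p.2.1.1 p.2.1.2)).trace.re) with hA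
  obtain ⟨m, W, c, t₀, hc, ht₀, hmb⟩ := hMB G hG r L hS z hz hz1 hrig q
  -- (MB) in the abstract form, for the action `V_e ↦ g(e.1) V_e g(e.1.shift e.2)⁻¹`
  have hmb' : ∀ V : GaugeConfig 4 (L + 1) G, A V ≤ t₀ → ∃ i : Fin m, ∃ g : Site 4 (L + 1) → G,
      ∀ e : Edge 4 (L + 1), c * ‖r.ρ (V e) - r.ρ (g e.1 * W i e * (g (e.1.shift e.2))⁻¹)‖ ^ 2 ≤ A V := by
    intro V hV
    obtain ⟨i, g, hg⟩ := hmb V hV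
    exact ⟨i, g, fun e => by simpa only [gaugeTransform] using hg e⟩
  obtain ⟨C, t₁, hC, ht₁, hsub⟩ := sublevel_measureReal_le_of_quadraticGrowth r.ρ (fun e : Edge 4 (L + 1) => e.1)
    (fun e : Edge 4 (L + 1) => e.1.shift e.2) r.continuous r.injective r.mem_unitary A W hc ht₀ hmb'
  -- the exponent: `D·3S⁴/2 = (3S⁴ − 1)D/2 + D/2`
  have hD : 0 < dimE r.ρ := by
    rw [Summit.QuantumFields.YangMills.Theorems.EquipartitionPinsProbe.dimE_eq_lieDim r]
    exact Summit.QuantumFields.YangMills.Theorems.EquipartitionPinsProbe.stub_liePos G hG r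
  have hcard : Fintype.card (Edge 4 (L + 1)) - Fintype.card (Site 4 (L + 1)) = 3 * (L + 1) ^ 4 :=
    card_edge_sub_card_site (L + 1)
  set k : ℝ := ((3 * ((L : ℝ) + 1) ^ 4 - 1) * (dimE r.ρ : ℝ)) / 2 + (dimE r.ρ : ℝ) / 2 with hk
  have hexp : ((dimE r.ρ * (Fintype.card (Edge 4 (L + 1)) - Fintype.card (Site 4 (L + 1))) : ℕ) : ℝ) / 2 = k := by
    rw [hcard, hk]; push_cast; ring
  have hk0 : 0 < k := by
    rw [← hexp, hcard]
    have : (0 : ℝ) < ((dimE r.ρ * (3 * (L + 1) ^ 4) : ℕ) : ℝ) := by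
      have h1 : 0 < dimE r.ρ * (3 * (L + 1) ^ 4) := Nat.mul_pos hD (by positivity)
      exact_mod_cast h1
    positivity
  have hsub' : ∀ u : ℝ, 0 < u → u ≤ t₁ →
      ((Measure.pi fun _ : Edge 4 (L + 1) => haarProbability G) {V | A V ≤ u}).toReal ≤ C * u ^ k := by
    intro u hu hut
    have h := hsub u hu hut
    rwa [hexp] at h
  obtain ⟨C', β₀, hC'⟩ := laplace_of_sublevel (GaugeConfig 4 (L + 1) G)
    (Measure.pi fun _ : Edge 4 (L + 1) => haarProbability G) A k C t₁ hk0 ht₁ hsub'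
  refine ⟨(dimE r.ρ : ℝ) / 2, by positivity, C', β₀, fun β hβ => ?_⟩
  have h := hC' β hβ
  rw [hZ β L z q]
  have hS : ((L + 1 : ℕ) : ℝ) = (L : ℝ) + 1 := by push_cast; ring
  rw [hS, ← hk]
  simpa [hA] using h

end Summit.QuantumFields.YangMills.Theorems.TwistExponentGap

end
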